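import Summits.CriticalPhenomena.PercolationContinuityZ3.Theorems.Transplant.SkelPhiRootBridgeKitsFC
import Summits.CriticalPhenomena.PercolationContinuityZ3.Theorems.Transplant.SkelPhiForcedRootKitClauseCQ
import Summits.CriticalPhenomena.PercolationContinuityZ3.Theorems.Transplant.SkelPhiForcedColumnPlaceQ
import HarnessLib

/-!
# Quasi-step rung (N3-b), BINDER WAVE, row Q41 «SkelPhiRootBridgeKitsFC» of WAVE-Q-BINDER-rows v0.7 under (ι) := `Skelφ.QStepsN G φ M`: **THE ROOT BRIDGE KIT FAMILY
# OVER THE RE-CENTRED FORCED KIT** when the base chart has only exact-footprint quasi-steps of cost `M` — **`hkits_bridgeFC_q`**, the twin of «SkelPhiRootBridgeKitsFC»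
# `hkits_bridgeFC` (which assumed `Steps G φ`)

builds on p205010 (kernel theorem, internal audit signed; external expert review pending) — nothing in this file uses p205010; nothing here is a claim about any open node
((N3-b), the end state); no carrier, no node, no definition.  Lane `prim-bschramm`, seat `prim-hp-8` (gen 62; binder-wave pen, family Forced*/Root*/RunKits/ApronKitDefs —
captain gen-1 g4, lane INBOX 2026-08-27 07:25Z).  thm row; FLOORS: `hPN : 1 ≤ P.N ↦ M ≤ P.N`, `KCmax ↦ P.N·KCmax` in `hDw`/`hT`/`hr₀`/`hrs`/`hE`/`hreach`, column cardinality
`KCmax + 1 ↦ (KCmax+1)(P.N+2)` in `hcS`.  Helper file (`--supports stmt-CriticalPhenomena-4575 --as helper`).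
WHY (hunk classes (i) binder `(hstep : Steps G φ) ↦ {M : ℕ} (hqφ : QStepsN G φ M)`; (ii) call sites `qStepsN_of_steps (steps_rootFrame hstep t hσ) ↦ hqφ.rootFrame t hσ`
(p504935), `kitClause_rootFrameFC ↦ kitClause_rootFrameFC_q` («SkelPhiForcedRootKitClauseCQ» Q32), `ψ_ctColEnd_mem_Icc/ctColEnd_reach/ctColEnd ↦ …_q/…_q/ctColEndQ`
(«SkelPhiForcedColumnPlaceQ» Q07, with the base cost bounded by the window cost, `hqφ.mono hPN` — located item L-hp8-1 (b), captain R-1); (iv) floors as above).  Proof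
otherwise byte-identical.  Regression: `qStepsN_of_steps` (`M = 1`).
* **`hkits_bridgeFC_q`**.
[cite: KozmaNitzan2024, §4 Lemma 10 (pp. 17–21), p. 28] [cite: MartineauTassion2017, §4.3 Lemma 4.2]
-/

noncomputable section

open scoped Classical

namespace Summit.CriticalPhenomena.PercolationContinuityZ3.Theorems.Transplant

namespace Skelφ

open MeasureTheory
open Literature.Probability.Percolation Literature.Probability.LatticeModels SimpleGraph KNLevels
open Literature.Barriers.CriticalPhenomena (graphBall graphBall_finite mem_graphBall_self graphBall_mono)
open Skel (winGraph winGraph_adj winGraph_le KitGeom)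
open SkelI (tanOff tanTgt tanTgt_mem)
open Literature.Probability.Percolation.KozmaNitzan.Cells (oth oth_ne eq_oth_of_ne oth_oth)
open ChainPlanar

variable {V : Type} [DecidableEq V] {G : SimpleGraph V} [G.LocallyFinite] {φ : V → Site 2}

/-! ## The bridge-step forced kit clause -/

/-- **THE FORCED KIT CLAUSE OF A BRIDGE-STEP LEVEL FROM THE BRIDGE EVENT AT EVERY CENTRE** (`hkits₁` of the bridge segment at its only step
`k = 0`, level `j`; the (S0) twin of p3-g9's `hkits_bridgeG`): the window is the root frame `rootFrame φ t σ` around `w₀` (radius `R`), the level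
box is `[B₀lo − j, B₀hi + j]`, the region `Dr ⊇ Win([regionLo, regionHi])` carries the subbox weighting `Wt`, the target
`T ⊇ Win([core1Lo, core1Hi]) ∪ (far part of the level)`; the zone datum `Λc c kz` at the kit centres; input at every centre `c`: the BRIDGE event
at accuracy `δ³` — region `Qb c ⊆ B(c, R_b)` read inside `rootFrame c ± pr`, piece `Fb c ⊆ Qb c` read inside `rootFrame c + [dlo, dhi]` (route datum
by p3-g9's `routeSets_bridge`). No zone estimate, no exit pieces ((S0)).
[cite: KozmaNitzan2024, §4 Lemma 10 (pp. 17–21), p. 28] [cite: MartineauTassion2017, §4.3 Lemma 4.2] [this work] -/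
theorem hkits_bridgeFC_q [Countable V] (hlipφ : Lip G φ) {M : ℕ} (hqφ : QStepsN G φ M) {Δ : ℕ} (hΔ : ∀ v, G.degree v ≤ Δ) {q : unitInterval} {δ : ℝ} (hδ : 0 < δ)
    -- the root frame and the bridge frame
    (t : V) {σ : ℤ} (hσ : σ = 1 ∨ σ = -1) (B : BridgePrm) {j : ℕ} {w₀ : V} {R r Rb : ℕ}
    -- kit constants
    (P : ApronPrm) {Mz Rs KCmax rs cS cU : ℕ} (hPN : M ≤ P.N) (hA : P.A = (Mz : ℤ) + 2)
    (hdD : P.d + 2 ≤ shellD P) (hDρ : Rs + 1 ≤ shellD P) (hKCmax : shellD P + Mz + 1 ≤ KCmax)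
    (hwide : ∀ i, (B.B₀lo - (j : Site 2)) i + 2 * tanOff P.ℓs P.M ≤ (B.B₀hi + (j : Site 2)) i)
    (hdw : ∀ i, (B.B₀lo - (j : Site 2)) i + (P.d + 2 : ℕ) ≤ (B.B₀hi + (j : Site 2)) i)
    (hDw : ∀ i, (B.B₀lo - (j : Site 2)) i + ((shellD P + 1 + P.d + P.N * KCmax + Rs : ℕ) : ℤ) ≤ (B.B₀hi + (j : Site 2)) i)
    (hT : (shellD P : ℤ) + P.N * KCmax + Rs ≤ tanOff P.ℓs P.M)
    (hr₀ : P.N * (tanOff P.ℓs P.M + 2) + P.N * P.d + (P.N * KCmax + Rs) ≤ P.r₀) (hR : P.r₀ ≤ R)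
    (hrs : 1 + (P.N * (tanOff P.ℓs P.M + 2) + P.N * P.d + (P.N * KCmax + Rs)) ≤ rs)
    (hcS : (P.N + 1) * (tanOff P.ℓs P.M + 1) + (P.N + 1) * P.d + (KCmax + 1) * (P.N + 2) + cU ≤ cS)
    -- the reach of the kit centre: inside the `R′`-enlargement, and `B(w₀, R − r)` with `R_b ≤ r ≤ R`
    (hE : j + (P.N * (tanOff P.ℓs P.M + 1) + P.N * P.d + P.N * KCmax) ≤ B.R')
    (hreach : r + (P.N * (tanOff P.ℓs P.M + 1) + P.N * P.d + P.N * KCmax) ≤ P.r₀) (hr : Rb ≤ r) (hrR : r ≤ R)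
    -- the short region and the zone datum at the kit centres (inside `Rg`, connected from the centre inside itself, containing the centre
    -- and the fat-prism zone box of record `cylBallFin c kz Rk`, `Rk ≥ cylRadMax types kz (2·KCmax)` — whence the forced column's end)
    (Rg : V → Finset V) (hRg : ∀ c, ∀ u ∈ Rg c, u ∈ graphBall G c Rs) (hRgcard : ∀ c, (Rg c).card ≤ cU) (hcU1 : 1 ≤ cU)
    (Λc : V → ℕ → Finset V) (kz : ℕ) (hΛRg : ∀ c, Λc c kz ⊆ Rg c) (hzconn : ∀ c, ∀ s ∈ Λc c kz, PathIn G (↑(Λc c kz) : Set V) c s)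
    (hcz : ∀ c, c ∈ Λc c kz)


    -- the bridge stride at every centre: region, piece, readings in the root frame
    (Qb Fb : V → Finset V)
    (hQb : ∀ c, ∀ w ∈ Qb c, w ∈ graphBall G c Rb ∧
      rootFrame φ t σ w ∈ Finset.Icc (rootFrame φ t σ c - ((B.pr : ℕ) : Site 2)) (rootFrame φ t σ c + ((B.pr : ℕ) : Site 2)))
    (hFb : ∀ c, ∀ w ∈ Fb c, w ∈ Qb c ∧ rootFrame φ t σ w ∈ Finset.Icc (rootFrame φ t σ c + B.dlo) (rootFrame φ t σ c + B.dhi))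
    -- the level's source/support, the weighting on the region, the target
    (kk : ℕ) (o : V) (Sfin : Finset V) {Wt : Sym2 V → unitInterval} {Dr T : Finset V} (hWD : IsSubbox (winGraph G w₀ R) Wt q Dr)
    (hPD : Win G (rootFrame φ t σ) w₀ (Finset.Icc B.regionLo B.regionHi) R ⊆ Dr)
    (hXD : winLevel G (rootFrame φ t σ) w₀ R B.B₀lo B.B₀hi j ⊆ Dr)
    (hPT : Win G (rootFrame φ t σ) w₀ (Finset.Icc B.core1Lo B.core1Hi) R ⊆ T)
    (hfarT : ∀ v ∈ winLevel G (rootFrame φ t σ) w₀ R B.B₀lo B.B₀hi j, v ∉ graphBall G w₀ (R - P.r₀) → v ∈ T)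
    {N : ℕ} (hN : kk * (Δ + 1) ^ (2 * rs) ≤ N) (hk : (1 - (q : ℝ) ^ (1 + Δ * cS + cS * cU)) ^ kk ≤ δ)
    -- THE INPUT AT EVERY CENTRE: the bridge event at accuracy `δ³`
    (hbridge : ∀ c, 1 - δ ^ 3 < (bondPercolation G q).real (linkIn (↑(Qb c) : Set V) (Λc c kz) (Fb c))) :
    ∃ (σ' : SData V) (S : Finset V),
      SHyp (winLData G (rootFrame φ t σ) w₀ R B.B₀lo B.B₀hi o Sfin) j σ' ∧ σ'.N ≤ N ∧ (1 - (q : ℝ) ^ σ'.sB) ^ σ'.k ≤ δ ∧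
      S ⊆ Dr ∧ (∀ x ∈ σ'.K, σ'.face x ⊆ S) ∧ RelayClause (winLData G (rootFrame φ t σ) w₀ R B.B₀lo B.B₀hi o Sfin) Wt j σ' S T Dr δ := by
  set ψ := rootFrame φ t σ with hψ
  set SF := rootSideU (φ := φ) t hσ (B.B₀lo - (j : Site 2)) (B.B₀hi + (j : Site 2)) with hSF
  have hKeq : winLevel G ψ w₀ R B.B₀lo B.B₀hi j = Win G ψ w₀ (Finset.Icc (B.B₀lo - (j : Site 2)) (B.B₀hi + (j : Site 2))) R := rfl
  -- the frame facts used for the reach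
  have hlip : Lip G ψ := lip_rootFrame hlipφ t hσ
  have hq : QStepsN G ψ P.N := (hqφ.rootFrame t hσ).mono hPN
  have hU1 : (1 : ℤ) ≤ 1 := le_rfl
  have haff : ∀ (i : Fin 2) (σ₀ : ℤˣ), (SF i σ₀).IsAffine 1 ((fun _ _ => (1 : ℤ)) i σ₀) := fun i σ₀ => by
    rw [hSF]; exact rootSideU_isAffine t hσ _ _ i σ₀
  have hC : ∀ (i : Fin 2) (σ₀ : ℤˣ), ((1 : ℕ) : ℤ) ≤ (fun _ _ => (1 : ℤ)) i σ₀ := fun _ _ => by simp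
  have hU : (1 : ℤ) ≤ ((0 + 1 : ℕ) : ℤ) * (1 : ℕ) := by simp
  have hA' : P.A = ((Mz + 1 : ℕ) : ℤ) * 1 + 1 := by rw [hA]; push_cast; ring
  have hKCmax' : (shellD P + Mz + 1) * (0 + 1) ≤ KCmax := by simpa using hKCmax
  have hKC := hKC_of_affine SF haff hU1 P (le_refl 1) hC hU hA' hKCmax'
  refine kitClause_rootFrameFC_q hlipφ hqφ hΔ hδ t hσ P hPN hA hdD hDρ hKCmax hwide hdw hDw hT hr₀ hR hrs hcS Rg hRg hRgcard hcU1 Λc kz hΛRg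
    hzconn hcz kk o Sfin hXD hN hk (fun x hx hfar => ?_) (fun x hx hnear => ?_)
  · -- FAR: the inner neighbour lies in the level and outside `B(w₀, R − r₀)`
    refine hfarT _ ?_ hfar
    have h := inNbr_spec (G := G) (φ := ψ) (by rw [hKeq] at hx; exact hx)
    rw [hKeq]
    exact (mem_Win G ψ).2 ⟨h.2.1, h.2.2⟩
  · -- NEAR: the bridge route datum at the kit centre (the zone-box disjunction's second branch)
    refine Or.inr ?_
    have hx' : x ∈ outerBoundary (winGraph G w₀ R) (Win G ψ w₀ (Finset.Icc (B.B₀lo - (j : Site 2)) (B.B₀hi + (j : Site 2))) R) := by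
      rw [hKeq] at hx; exact hx
    set c := ctColEndQ G SF P w₀ R x with hc
    -- the centre's frame image and window position
    have hcI : ψ c ∈ Finset.Icc (B.B₀lo - ((B.R' : ℕ) : Site 2)) (B.B₀hi + ((B.R' : ℕ) : Site 2)) :=
      ψ_ctColEnd_mem_Icc_q SF hlip hq (hqφ.mono hPN) hwide (fun i σ₀ z h1 h2 => hKC i σ₀ z h1) hE hx
    have hcw : c ∈ graphBall G w₀ (R - r) := by
      have hd := ctColEnd_reach_q SF hlip hq (hqφ.mono hPN) hwide (fun i σ₀ z h1 h2 => hKC i σ₀ z h1) hx'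
      have h := BoxProdZ2.mem_graphBall_add G hnear hd
      exact graphBall_mono G _ (by omega) h
    obtain ⟨Qt, Ft, hFT, hQD, -, hlt⟩ :=
      routeSets_bridge t σ B hcI hcw hr hrR (hQb c) (hFb c) (Z := ∅) (Finset.disjoint_empty_right _) hPD hPT hWD (hbridge c)
    exact ⟨Qt, Ft, hFT, hQD, hlt.le⟩

end Skelφ

end Summit.CriticalPhenomena.PercolationContinuityZ3.Theorems.Transplant

end
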